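/-
Origin: expansion seat `planner-pub-hodgecm-pv14-g6-0`, handover import Pv14g6.SchrodingerInfinitesimal -> import HodgeCM.Automorphic.SchrodingerInfinitesimal ; after SchrodingerInfinitesimal (this seat row 10, same run) (`HOME/pub-hodgecm-pv14-g6/lean/Pv14g6/SchrodingerSmoothVectors.lean`, md5 8c024b22, 119 lines);
landed by the gen-8 packager in gate run 30 as `HodgeCM/Automorphic/SchrodingerSmoothVectors.lean` (import ^import Pv14g6\.SchrodingerInfinitesimal[ \t]*$→import HodgeCM.Automorphic.SchrodingerInfinitesimal ×1).
-/
/-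
Copyright (c) 2026. All rights reserved.
Released under Apache 2.0 license as described in the file LICENSE.
Origin: pub-hodgecm-pv14-g6 (DAG-node prover #14, gen 6), file #13; target
`HodgeCM/Automorphic/SchrodingerSmoothVectors.lean` (namespace `HodgeCM.SchwartzWeil`).  NEW ADDITIVE LEAF.
-/
import Summits.HodgeConjecture.HodgeCM.Automorphic.SchrodingerInfinitesimal

/-!
# Schwartz functions are smooth vectors of the Schrödinger representation

For the weight-`m` Schrödinger representation `ρ_m` of `Heis V` on `𝓢(V, ℂ)` and the one-parameter subgroups
`γ = Heis.expCurve a b c`, with generator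
`dρ_m(a,b,c) Φ = schrodingerGen V m a b c Φ = -∂_{a} Φ + (2πi ⟪m b, ·⟫) Φ + (2πi m c) • Φ`
(`SchrodingerInfinitesimal`), we prove, for every Schwartz `Φ` and every continuous `ℝ`-linear map `T` from
`𝓢(V, ℂ)` to a normed space:

* `hasDerivAt_repCLM_expCurve_at` : `s ↦ T (ρ_m(γ(s)) Φ)` has derivative `T (ρ_m(γ(s₀)) (dρ_m Φ))` at EVERY
  `s₀` (group law `Heis.expCurve_add` + `repCLM_mul`);
* `iteratedDeriv_repCLM_expCurve` : its `n`-th derivative is `s ↦ T (ρ_m(γ(s)) (dρ_m^[n] Φ))`;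
* `contDiff_repCLM_expCurve` : **it is `C^∞`** — Schwartz functions are smooth vectors for `ρ_m` along every
  one-parameter subgroup, in the scalarised sense appropriate to the (non-normable) Fréchet space `𝓢`.

Not here: smoothness on the group `Heis V` as a manifold (joint in several parameters), analytic vectors.
-/

noncomputable section

open scoped Real FourierTransform SchwartzMap RealInnerProductSpace Topology LineDeriv
open Complex Filter

namespace HodgeCM
namespace SchwartzWeil

variable {V : Type} [NormedAddCommGroup V] [InnerProductSpace ℝ V]

namespace Heis

/-- (Ported verbatim from the HodgeCMPerL package; no docstring in the source.) -/
theorem continuous_expCurve (a b : V) (c : ℝ) : Continuous (expCurve a b c) :=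
  continuous_mk (continuous_id.smul continuous_const) (continuous_id.smul continuous_const)
    (Real.continuous_fourierChar.comp (by fun_prop))

/-- (Ported verbatim from the HodgeCMPerL package; no docstring in the source.) -/
theorem expCurve_eq_mul_sub (a b : V) (c s₀ s : ℝ) :
    expCurve a b c s = expCurve a b c s₀ * expCurve a b c (s - s₀) := by
  rw [← expCurve_add, add_sub_cancel]

end Heis

variable (V) (m : ℤ)

/-- The generator `dρ_m(a, b, c) = -∂_{a} + 2πi ⟪m b, ·⟫ + 2πi m c` on `𝓢(V, ℂ)`. -/
def schrodingerGen (a b : V) (c : ℝ) (Φ : 𝓢(V, ℂ)) : 𝓢(V, ℂ) :=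
  -∂_{a} Φ + SchwartzMap.smulLeftCLM ℂ (fun x : V => 2 * π * I * ((⟪(m : ℝ) • b, x⟫ : ℝ) : ℂ)) Φ
    + (2 * π * I * ((m : ℝ) * c)) • Φ

/-- (Ported verbatim from the HodgeCMPerL package; no docstring in the source.) -/
theorem schrodingerGen_def (a b : V) (c : ℝ) (Φ : 𝓢(V, ℂ)) :
    schrodingerGen V m a b c Φ = -∂_{a} Φ
      + SchwartzMap.smulLeftCLM ℂ (fun x : V => 2 * π * I * ((⟪(m : ℝ) • b, x⟫ : ℝ) : ℂ)) Φ
      + (2 * π * I * ((m : ℝ) * c)) • Φ := rfl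

variable [FiniteDimensional ℝ V] [MeasurableSpace V] [BorelSpace V]

/-- Strong continuity of `ρ_m` along `γ_{a,b,c}`. -/
theorem continuous_repCLM_expCurve (a b : V) (c : ℝ) (Φ : 𝓢(V, ℂ)) :
    Continuous fun s : ℝ => repCLM V m (Heis.expCurve a b c s) Φ :=
  (continuous_repCLM_uncurry V m).comp ((Heis.continuous_expCurve a b c).prodMk continuous_const)

variable {F : Type*} [NormedAddCommGroup F] [NormedSpace ℝ F]

/-- **Derivative at every point.**  `s ↦ T (ρ_m(γ(s)) Φ)` has derivative `T (ρ_m(γ(s₀)) (dρ_m Φ))` at `s₀`. -/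
theorem hasDerivAt_repCLM_expCurve_at (a b : V) (c : ℝ) (Φ : 𝓢(V, ℂ)) (T : 𝓢(V, ℂ) →L[ℝ] F) (s₀ : ℝ) :
    HasDerivAt (fun s : ℝ => T (repCLM V m (Heis.expCurve a b c s) Φ))
      (T (repCLM V m (Heis.expCurve a b c s₀) (schrodingerGen V m a b c Φ))) s₀ := by
  set T' : 𝓢(V, ℂ) →L[ℝ] F := T.comp ((repCLM V m (Heis.expCurve a b c s₀)).restrictScalars ℝ) with hT'
  have h0 : HasDerivAt (fun t : ℝ => T' (repCLM V m (Heis.expCurve a b c t) Φ))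
      (T' (schrodingerGen V m a b c Φ)) (s₀ - s₀) := by
    rw [sub_self]
    exact hasDerivAt_repCLM_expCurve V m a b c Φ T'
  have h1 := h0.comp_sub_const s₀ s₀
  refine (h1.congr_of_eventuallyEq (Eventually.of_forall fun s => ?_)).congr_deriv rfl
  show T _ = T' _
  rw [Heis.expCurve_eq_mul_sub a b c s₀ s, repCLM_mul_apply]
  rfl

/-- (Ported verbatim from the HodgeCMPerL package; no docstring in the source.) -/
theorem deriv_repCLM_expCurve (a b : V) (c : ℝ) (Φ : 𝓢(V, ℂ)) (T : 𝓢(V, ℂ) →L[ℝ] F) :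
    deriv (fun s : ℝ => T (repCLM V m (Heis.expCurve a b c s) Φ)) =
      fun s => T (repCLM V m (Heis.expCurve a b c s) (schrodingerGen V m a b c Φ)) :=
  funext fun s => (hasDerivAt_repCLM_expCurve_at V m a b c Φ T s).deriv

/-- **Iterated derivatives.** -/
theorem iteratedDeriv_repCLM_expCurve (a b : V) (c : ℝ) (T : 𝓢(V, ℂ) →L[ℝ] F) (n : ℕ) (Φ : 𝓢(V, ℂ)) :
    iteratedDeriv n (fun s : ℝ => T (repCLM V m (Heis.expCurve a b c s) Φ)) =
      fun s => T (repCLM V m (Heis.expCurve a b c s) ((schrodingerGen V m a b c)^[n] Φ)) := by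
  induction n generalizing Φ with
  | zero => simp
  | succ n ih =>
    rw [iteratedDeriv_succ', deriv_repCLM_expCurve, ih, Function.iterate_succ_apply]

/-- (Ported verbatim from the HodgeCMPerL package; no docstring in the source.) -/
theorem differentiable_repCLM_expCurve (a b : V) (c : ℝ) (Φ : 𝓢(V, ℂ)) (T : 𝓢(V, ℂ) →L[ℝ] F) :
    Differentiable ℝ (fun s : ℝ => T (repCLM V m (Heis.expCurve a b c s) Φ)) :=
  fun s => (hasDerivAt_repCLM_expCurve_at V m a b c Φ T s).differentiableAt

/-- **Schwartz functions are smooth vectors for `ρ_m` along every one-parameter subgroup** (scalarised through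
any continuous `ℝ`-linear `T` into a normed space). -/
theorem contDiff_repCLM_expCurve (a b : V) (c : ℝ) (Φ : 𝓢(V, ℂ)) (T : 𝓢(V, ℂ) →L[ℝ] F) :
    ContDiff ℝ (⊤ : ℕ∞) (fun s : ℝ => T (repCLM V m (Heis.expCurve a b c s) Φ)) := by
  refine contDiff_of_differentiable_iteratedDeriv fun n _ => ?_
  rw [iteratedDeriv_repCLM_expCurve]
  exact differentiable_repCLM_expCurve V m a b c _ T

/-- In particular every matrix coefficient / point evaluation `s ↦ (ρ_m(γ(s)) Φ)(x)` is smooth. -/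
theorem contDiff_repCLM_expCurve_apply (a b : V) (c : ℝ) (Φ : 𝓢(V, ℂ)) (x : V) :
    ContDiff ℝ (⊤ : ℕ∞) (fun s : ℝ => repCLM V m (Heis.expCurve a b c s) Φ x) := by
  simpa only [ContinuousLinearMap.comp_apply, BoundedContinuousFunction.evalCLM_apply,
    SchwartzMap.toBoundedContinuousFunctionCLM_apply] using contDiff_repCLM_expCurve V m a b c Φ
      ((BoundedContinuousFunction.evalCLM ℝ x).comp (SchwartzMap.toBoundedContinuousFunctionCLM ℝ V ℂ))

end SchwartzWeil
end HodgeCM
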